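import Mathlib.Analysis.SpecialFunctions.Trigonometric.Series
import Mathlib.Analysis.SpecialFunctions.Trigonometric.DerivHyp
import Mathlib.Analysis.Complex.Exponential
import Mathlib.Data.Matrix.Basic
import Literature.MathematicalPhysics.QuantumLattice.TorusTestPotential
import HarnessLib

/-!
# Route `UnitScaleTilt`, crux K1 «MinimiserStabilityRegPr» (stmt-QuantumFields-19200), EX rows `h349` ∕ `hGF` (curved member) — **LOD LINE BOOKKEEPING (★p1 g24) FOR (L3′a):
# THE COSH-BUDGET OF A FINITE-STENCIL MATRIX AND THE NUMERAL `cosh x − 1 ≤ x²`** — how a member turns «entries `≤ s` within fine distance `ρ`, at most `N` neighbours» into the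
# hypothesis `Σ_l (cosh(μ d(i,l)) − 1)‖A i l‖ ≤ N·s·(cosh(μρ) − 1) ≤ N·s·(μρ)²` of the Hermitian cosh-budget Combes–Thomas bound (`…Prop7HermitianCoshBudgetCT.inv_decay_of_hermitian_coshBudget`).
# At a T³ member: `ρ = η`, `s ~ η⁻²`, `N = 6` ⟹ budget `≤ 6μ²` — K-UNIFORM (CARD-19200-V3-g24 §5).

Cell `ym3-torus` (HUMAN RULING D-0037, YM ladder rung R3 — NOT d = 4, NOT a mass gap, NOT Clay).  Fleet lead seat `ym-ust-19200-p1` gen 24.  THEOREMS ONLY (0 `def`, 0 `sorry`), Mathlib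
only; `--supports stmt-QuantumFields-19200 --as helper`, count-neutral.  HONEST LABEL (№33 (6)): curved γ-row supplier line (LOD localisation); bookkeeping; nothing of (3.49),
Thm 3.1∕3.3, `h349`, `hGF`, EX ∕ 19200 is proved.

WHAT IS PROVED (ns `Summit.QuantumFields.YangMills.Theorems.Prop7CoshBudgetOfStencil`).
* the numeral `|x| ≤ 1 ⟹ cosh x − 1 ≤ x²` is lit ✓`QuantumLattice.cosh_sub_one_le_sq_of_abs_le_one` (reused, not restated).
* ★ `coshBudget_of_range` — pseudo-metric `d ≥ 0`, `A i l = 0` beyond `d`-range `ρ`, `‖A i l‖ ≤ s` for `0 < d i l`, at most `N` indices within distance `ρ`: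
  `Σ_l (cosh(μ d(i,l)) − 1)‖A i l‖ ≤ N·s·(cosh(μρ) − 1)` (in-range in-block entries at distance `0` are free).
* ★ `coshBudget_of_range_sq` — with `μρ ≤ 1`: `≤ N·s·(μρ)²`.

References: T. Bałaban, CMP **99** (1985) 389–434 [Balaban1985BackgroundPropagators] (Thm 3.1 p.397); S. Agmon, *Lectures on exponential decay* (1982).
-/

set_option autoImplicit false

noncomputable section

open scoped Matrix BigOperators
open Finset

namespace Summit.QuantumFields.YangMills.Theorems.Prop7CoshBudgetOfStencil

open Literature.MathematicalPhysics.QuantumLattice (cosh_sub_one_le_sq_of_abs_le_one)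

variable {n : Type*} [Fintype n]

omit [Fintype n] in
/-- `cosh` is monotone in `|·|`: `0 ≤ a ≤ b ⟹ cosh a ≤ cosh b`. [cite: Balaban1985BackgroundPropagators, Thm 3.1 p.397] -/
theorem cosh_le_cosh_of_nonneg_of_le {a b : ℝ} (ha : 0 ≤ a) (hab : a ≤ b) : Real.cosh a ≤ Real.cosh b :=
  Real.cosh_le_cosh.mpr (by rw [abs_of_nonneg ha, abs_of_nonneg (ha.trans hab)]; exact hab)

/-- ★ **COSH-BUDGET OF A FINITE STENCIL**: `Σ_l (cosh(μ d(i,l)) − 1)·‖A i l‖ ≤ N·s·(cosh(μρ) − 1)`. [cite: Balaban1985BackgroundPropagators, Thm 3.1 p.397] -/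
theorem coshBudget_of_range (d : n → n → ℝ) (hdnn : ∀ i j, 0 ≤ d i j) (A : Matrix n n ℂ) {ρ s μ : ℝ} {N : ℕ} (hs : 0 ≤ s) (hμ : 0 ≤ μ)
    (hAρ : ∀ i l, ρ < d i l → A i l = 0) (hAs : ∀ i l, 0 < d i l → ‖A i l‖ ≤ s) (hN : ∀ i, (univ.filter fun l => d i l ≤ ρ).card ≤ N) (i : n) :
    ∑ l, (Real.cosh (μ * d i l) - 1) * ‖A i l‖ ≤ N * s * (Real.cosh (μ * ρ) - 1) := by
  have hcρ : 0 ≤ Real.cosh (μ * ρ) - 1 := by linarith [Real.one_le_cosh (μ * ρ)]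
  have hterm : ∀ l, (Real.cosh (μ * d i l) - 1) * ‖A i l‖ ≤ if d i l ≤ ρ then s * (Real.cosh (μ * ρ) - 1) else 0 := by
    intro l
    split_ifs with h
    · by_cases h0 : 0 < d i l
      · have hc1 : Real.cosh (μ * d i l) - 1 ≤ Real.cosh (μ * ρ) - 1 :=
          sub_le_sub_right (cosh_le_cosh_of_nonneg_of_le (mul_nonneg hμ (hdnn i l)) (mul_le_mul_of_nonneg_left h hμ)) 1
        have hc0 : 0 ≤ Real.cosh (μ * d i l) - 1 := by linarith [Real.one_le_cosh (μ * d i l)]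
        calc (Real.cosh (μ * d i l) - 1) * ‖A i l‖ ≤ (Real.cosh (μ * ρ) - 1) * s := mul_le_mul hc1 (hAs i l h0) (norm_nonneg _) hcρ
          _ = s * (Real.cosh (μ * ρ) - 1) := mul_comm _ _
      · have : d i l = 0 := le_antisymm (le_of_not_gt h0) (hdnn i l)
        rw [this, mul_zero, Real.cosh_zero, sub_self, zero_mul]
        exact mul_nonneg hs hcρ
    · rw [hAρ i l (lt_of_not_ge h), norm_zero, mul_zero]
  refine (Finset.sum_le_sum fun l _ => hterm l).trans ?_
  rw [Finset.sum_ite, Finset.sum_const_zero, add_zero, Finset.sum_const, nsmul_eq_mul]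
  have hnn : 0 ≤ s * (Real.cosh (μ * ρ) - 1) := mul_nonneg hs hcρ
  calc ((univ.filter fun l => d i l ≤ ρ).card : ℝ) * (s * (Real.cosh (μ * ρ) - 1)) ≤ N * (s * (Real.cosh (μ * ρ) - 1)) :=
        mul_le_mul_of_nonneg_right (by exact_mod_cast hN i) hnn
    _ = N * s * (Real.cosh (μ * ρ) - 1) := by ring

/-- ★ **THE K-UNIFORM NUMERAL**: with `μρ ≤ 1` the cosh-budget is `≤ N·s·(μρ)²` (member: `ρ = η`, `s = cη⁻²` ⟹ `≤ N·c·μ²`). [cite: Balaban1985BackgroundPropagators, Thm 3.1 p.397] -/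
theorem coshBudget_of_range_sq (d : n → n → ℝ) (hdnn : ∀ i j, 0 ≤ d i j) (A : Matrix n n ℂ) {ρ s μ : ℝ} {N : ℕ} (hs : 0 ≤ s) (hμ : 0 ≤ μ) (hρ : 0 ≤ ρ)
    (hμρ : μ * ρ ≤ 1)
    (hAρ : ∀ i l, ρ < d i l → A i l = 0) (hAs : ∀ i l, 0 < d i l → ‖A i l‖ ≤ s) (hN : ∀ i, (univ.filter fun l => d i l ≤ ρ).card ≤ N) (i : n) :
    ∑ l, (Real.cosh (μ * d i l) - 1) * ‖A i l‖ ≤ N * s * (μ * ρ) ^ 2 := by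
  refine (coshBudget_of_range d hdnn A hs hμ hAρ hAs hN i).trans ?_
  have h : Real.cosh (μ * ρ) - 1 ≤ (μ * ρ) ^ 2 := cosh_sub_one_le_sq_of_abs_le_one (by rw [abs_of_nonneg (mul_nonneg hμ hρ)]; exact hμρ)
  exact mul_le_mul_of_nonneg_left h (by positivity)

end Summit.QuantumFields.YangMills.Theorems.Prop7CoshBudgetOfStencil

end
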